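import Summits.KontsevichZagierPeriods.KontsevichZagierPeriods.Theorems.SymplecticScissorsRealOnePeriodRelationsStubHwLogsLoopsFamily
import Summits.KontsevichZagierPeriods.KontsevichZagierPeriods.Theorems.SymplecticScissorsRealOnePeriodRelationsStubLogsIsotypicSplitting
import Summits.KontsevichZagierPeriods.KontsevichZagierPeriods.Theorems.SymplecticScissorsRealOnePeriodRelationsStubLogsManyCurve
import Summits.KontsevichZagierPeriods.KontsevichZagierPeriods.Theorems.SymplecticScissorsRealOnePeriodRelationsStubRatLoopCells
import Summits.KontsevichZagierPeriods.KontsevichZagierPeriods.Theorems.SymplecticScissorsRealOnePeriodRelationsStubRatLoopArcs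
import Summits.KontsevichZagierPeriods.KontsevichZagierPeriods.Theorems.SymplecticScissorsRealOnePeriodRelationsLoopLayerLegendre

/-!
# Crux `RealOnePeriodRelations` (stmt-KontsevichZagierPeriods-10042) — THE LOG–LOOP LAYER, UNCONDITIONALLY
# (logarithms together with complete real elliptic integrals on any finite family; CM and isogenies allowed)

Line `nash-retraction-thin-strip`, gen-1 lead, continuation c4 (reshape 6).  The line is complete modulo its apex, the named
fact `HuberWustholzCurvePeriods` (Huber–Wüstholz 2022, Thm 13.3 (2) for ALL smooth affine curves).  Its unconditional layers so
far — the RATIONAL layer (genus `0`, arbitrary paths: logarithms; Baker) and the LOOP layer (closed paths on any finite family of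
elliptic curves: complete elliptic integrals; the isotypic splitting) — were separate: a `ℤ`-relation mixing `π`, `log 2` and
`K(k)` was covered by neither.  This file joins them.  The transcendence input is NEW as a statement though entirely inside the
tree as a proof: the family semistability engine `GaGmEFam` (`GaGmEFam.Std.stableClosing_of_philippon philippon_family`: Baker's
method with Philippon's zero estimate on the family standard models `𝔾ₘ^β × P`) works at ARBITRARY algebraic points of the torus
`𝔾ₘ^β`, i.e. at arbitrary logarithms of algebraic numbers, with torsion abelian part (complete periods) — BAKER'S THEOREM AND
HUBER–WÜSTHOLZ 15.3 (1) JOINTLY (`LogLoopLayer.stub_logsManyCurve`, `LogLoopLayer.stub_logsIsotypicSplitting`), whence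
Huber–Wüstholz 13.3 (2) for arbitrary paths on the punctured lines `Z_a`, `𝔾ₘ`, `𝔸¹` together with closed paths on any finite
family of elliptic curves over `ℚ̄` (`LogLoopLayer.stub_hwLogsLoopsFamily`), and through `SectorGlue.realOnePeriodRelations_of_sector`
with `stub_ratLoopCells` / `stub_ratLoopArcs`:

* `realOnePeriodRelations_ratLoopLayer` — for ANY finite family of real Weierstrass curves `y² = x³ + A_j x + B_j` over `ℚ̄ ∩ ℝ`:
  every `ℤ`-combination with vanishing value of RATIONAL representations (Kontsevich–Zagier's literal shape in dimension one:
  a `ℚ`-semialgebraic domain in `ℝ` and an integrand `p/q`, `p, q ∈ ℚ[x]` — values `1`, `log 2`, `π = ∫₀¹ 4/(1+x²)`, …),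
  polynomial cells `∫_a^b P`, complete first/second-kind integrals over real ovals `∫_{e₁}^{e₂} (P₁ + P₂√f_j + P₃/√f_j)` and
  complete integrals over real branches `∫_e^∞ c₀/√f_j` lies in `M₁ = closure (1a ∪ 1b ∪ 2 ∪ Green)`;
* `realOnePeriodRelations_ratLoopLayer_one` — one real elliptic curve (CM allowed) with the rational representations;
* `realOnePeriodRelations_ratLegendreLayer` — the rational representations together with the Legendre forms
  `∫₀¹ P(x²) dx/√((1−x²)(1−k_j²x²))` (`K(k_j)`, `E(k_j)`, …) at finitely many algebraic moduli `0 < k_j < 1` (singular moduli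
  included) and polynomial cells: every `ℤ`-relation with value `0` among `π`, logarithms of rational numbers, algebraic numbers and
  complete elliptic integrals of the first and second kind at algebraic moduli is generated by 1a, 1b, 2 and Green — and by the
  splitting there is NO such relation mixing the genus-`0` values with the elliptic ones or two isogeny classes beyond those.

[cite: HuberWustholz2022, Thm 13.3 (2), §13.2, Thm 15.3 (1),(3), §15.2.2, Rem. 15.11] [cite: BakerWustholz2007, Thm. 6.15, §6.8]
[cite: Masser1975, Ch. III Thm. III] [cite: KontsevichZagier2001, §1.1–§1.2]
-/

noncomputable section

open scoped BigOperators Polynomial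
open Set MeasureTheory MvPolynomial
open Literature.NumberTheory.Transcendental Literature.NumberTheory.Transcendental.CurvePeriods
open Summit.KontsevichZagierPeriods.SymplecticScissors.RealOnePeriodRelationsNegative (M₁ H₁ crux_iff unitDom)

namespace Summit.KontsevichZagierPeriods.SymplecticScissors.RealOnePeriodRelations

namespace LogLoopLayer

/-- **THE LOG–LOOP LAYER OF THE CRUX, UNCONDITIONALLY.**  Let `E_j : y² = x³ + A_j x + B_j` (`j < k`, `A_j, B_j` real
algebraic) be ANY finite family of real elliptic curves over `ℚ̄ ∩ ℝ` with lattices `L_j` (`g₂ = −4A_j`, `g₃ = −4B_j`;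
complex multiplication and isogenies allowed).  Every `ℤ`-combination with vanishing value of
* RATIONAL representations (Kontsevich–Zagier's literal shape: a `ℚ`-semialgebraic domain in `ℝ`, integrand `p/q` with
  `p, q ∈ ℚ[x]`, `q ≠ 0` on the domain, absolutely integrable — values `1`, `log 2`, `π = ∫₀¹ 4/(1+x²)`, …);
* polynomial cells `∫_a^b P` (`a < b` real algebraic, `P ∈ (ℚ̄ ∩ ℝ)[x]`);
* COMPLETE first/second-kind integrals over real ovals `∫_{e₁}^{e₂} (P₁ + P₂√f_j + P₃/√f_j)` (`e₁ < e₂` consecutive real roots);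
* complete integrals over real branches `∫_e^∞ c₀/√f_j` (`e` the largest real root)
lies in `M₁ = closure (1a ∪ 1b ∪ 2 ∪ Green)`.  Proof: `SectorGlue.realOnePeriodRelations_of_sector` with `stub_ratLoopCells`,
`stub_ratLoopArcs` and `stub_hwLogsLoopsFamily (stub_logsIsotypicSplitting stub_logsManyCurve)`.
[cite: HuberWustholz2022, Thm 13.3 (2), Thm 15.3 (1),(3), Rem. 15.11] [cite: KontsevichZagier2001, §1.1–§1.2] -/
theorem realOnePeriodRelations_ratLoopLayer : ∀ (k : ℕ) (A B : Fin k → ℝ), (∀ j, IsAlgebraic ℚ (A j)) →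
    (∀ j, IsAlgebraic ℚ (B j)) → ∀ (L : Fin k → PeriodPair), (∀ j, (L j).g₂ = -4 * (A j : ℂ)) →
    (∀ j, (L j).g₃ = -4 * (B j : ℂ)) →
    ∀ c : KZ.FormalRep, c ∈ AddSubgroup.closure ((fun r : KZ.IntegralRep 1 => KZ.of r) ''
      {r | r.IsRational ∨
        (∃ a b : ℝ, IsAlgebraic ℚ a ∧ IsAlgebraic ℚ b ∧ a < b ∧ r.domain = {z | z 0 ∈ Set.Ioo a b} ∧
            ∃ P : Polynomial (algebraicClosure ℚ ℝ), ∀ x ∈ Set.Ioo a b, r.integrand (fun _ => x) = Polynomial.aeval x P) ∨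
        (∃ j, ∃ e₁ e₂ : ℝ, IsAlgebraic ℚ e₁ ∧ IsAlgebraic ℚ e₂ ∧ e₁ < e₂ ∧ e₁ ^ 3 + A j * e₁ + B j = 0 ∧
          e₂ ^ 3 + A j * e₂ + B j = 0 ∧ (∀ x ∈ Set.Ioo e₁ e₂, 0 < x ^ 3 + A j * x + B j) ∧
          r.domain = {z | z 0 ∈ Set.Ioo e₁ e₂} ∧
          ∃ P₁ P₂ P₃ : Polynomial (algebraicClosure ℚ ℝ), ∀ x ∈ Set.Ioo e₁ e₂,
            r.integrand (fun _ => x) = Polynomial.aeval x P₁ + Polynomial.aeval x P₂ * Real.sqrt (x ^ 3 + A j * x + B j) +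
              Polynomial.aeval x P₃ / Real.sqrt (x ^ 3 + A j * x + B j)) ∨
        (∃ j, ∃ e c₀ : ℝ, IsAlgebraic ℚ e ∧ IsAlgebraic ℚ c₀ ∧ e ^ 3 + A j * e + B j = 0 ∧
          (∀ x : ℝ, e < x → 0 < x ^ 3 + A j * x + B j) ∧ r.domain = {z | e < z 0} ∧
          ∀ z ∈ r.domain, r.integrand z = c₀ / Real.sqrt ((z 0) ^ 3 + A j * (z 0) + B j))}) →
    KZ.eval c = 0 →
    c ∈ AddSubgroup.closure (KZ.domainAddRel ∪ KZ.integrandAddRel ∪ KZ.changeOfVariablesRel ∪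
      {g : KZ.FormalRep | ∃ (Δ : Set (Fin 2 → ℝ)) (A B S : (Fin 2 → ℝ) → ℝ) (r₀₁ r₁₂ r₀₂ : KZ.IntegralRep 1),
        Δ = {p | 0 ≤ p 0 ∧ 0 ≤ p 1 ∧ p 0 + p 1 ≤ 1} ∧ IsSemialgebraicFunOn ℚ Δ A ∧ IsSemialgebraicFunOn ℚ Δ B ∧
        ContinuousOn A Δ ∧ ContinuousOn B Δ ∧
        (∀ p : Fin 2 → ℝ, 0 < p 0 → 0 < p 1 → p 0 + p 1 < 1 →
          HasFDerivAt S (A p • ContinuousLinearMap.proj (R := ℝ) (φ := fun _ : Fin 2 => ℝ) 0 +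
            B p • ContinuousLinearMap.proj (R := ℝ) (φ := fun _ : Fin 2 => ℝ) 1) p) ∧
        r₀₁.domain = {z | z 0 ∈ Set.Ioo 0 1} ∧ r₁₂.domain = {z | z 0 ∈ Set.Ioo 0 1} ∧
        r₀₂.domain = {z | z 0 ∈ Set.Ioo 0 1} ∧ (∀ z ∈ r₀₁.domain, r₀₁.integrand z = A ![z 0, 0]) ∧
        (∀ z ∈ r₁₂.domain, r₁₂.integrand z = B ![1 - z 0, z 0] - A ![1 - z 0, z 0]) ∧
        (∀ z ∈ r₀₂.domain, r₀₂.integrand z = B ![0, z 0]) ∧ g = KZ.of r₀₁ + KZ.of r₁₂ - KZ.of r₀₂}) := by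
  intro k A B hA hB L hL₂ hL₃ c hc heval
  change c ∈ M₁
  have hD : ∀ j, 4 * A j ^ 3 + 27 * B j ^ 2 ≠ 0 := by
    intro j h
    apply (L j).discr_ne_zero
    rw [hL₂ j, hL₃ j]
    have h' : ((4 * A j ^ 3 + 27 * B j ^ 2 : ℝ) : ℂ) = 0 := by rw [h]; simp
    push_cast at h'
    linear_combination (-16 : ℂ) * h'
  have hg : ∀ j, IsAlgebraic ℚ (L j).g₂ ∧ IsAlgebraic ℚ (L j).g₃ := fun j =>
    ⟨by rw [hL₂ j]; exact ((isAlgebraic_int 4).neg).mul (hA j).algebraMap,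
     by rw [hL₃ j]; exact ((isAlgebraic_int 4).neg).mul (hB j).algebraMap⟩
  refine SectorGlue.realOnePeriodRelations_of_sector _ _ _ (fun C hCalg hCsupp hC0 => ?_)
    (stub_ratLoopCells k A B hA hB) (stub_ratLoopArcs k A B hA hB hD) c hc heval
  refine stub_hwLogsLoopsFamily (stub_logsIsotypicSplitting stub_logsManyCurve) k L hg C hCalg (fun s hs => ?_) hC0
  rcases hCsupp s hs with hP | hU | ⟨j, hj, hcl⟩
  · exact Or.inr (Or.inl hP)
  · exact Or.inr (Or.inr (Or.inr (by rw [hU]; rfl)))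
  · exact Or.inl ⟨j, hj.trans (Ell.curve_eq_weierCurve (hL₂ j) (hL₃ j)).symm, hcl⟩

/-- **THE LOG–LOOP LAYER ON ONE REAL ELLIPTIC CURVE, CM ALLOWED** (the one-element family): for `E : y² = x³ + Ax + B`
(`A, B` real algebraic) with lattice `L` (`g₂ = −4A`, `g₃ = −4B`), every `ℤ`-combination with vanishing value of rational
representations, polynomial cells, complete integrals over the real oval and over the real branch lies in `M₁` — e.g. NO
`ℤ`-relation `a·[π] + b·[log 2] + c·[∫_{e₁}^{e₂} dx/√f] + …` with value `0` exists outside `M₁`, and by the splitting none at all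
mixes `π`/logarithms with the elliptic periods beyond those of the separate layers.
[cite: HuberWustholz2022, Thm 13.3 (2), Thm 15.3 (1)] [cite: KontsevichZagier2001, §1.2] -/
theorem realOnePeriodRelations_ratLoopLayer_one : ∀ (A B : ℝ), IsAlgebraic ℚ A → IsAlgebraic ℚ B →
    ∀ (L : PeriodPair), L.g₂ = -4 * (A : ℂ) → L.g₃ = -4 * (B : ℂ) →
    ∀ c : KZ.FormalRep, c ∈ AddSubgroup.closure ((fun r : KZ.IntegralRep 1 => KZ.of r) ''
      {r | r.IsRational ∨
        (∃ a b : ℝ, IsAlgebraic ℚ a ∧ IsAlgebraic ℚ b ∧ a < b ∧ r.domain = {z | z 0 ∈ Set.Ioo a b} ∧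
            ∃ P : Polynomial (algebraicClosure ℚ ℝ), ∀ x ∈ Set.Ioo a b, r.integrand (fun _ => x) = Polynomial.aeval x P) ∨
        (∃ e₁ e₂ : ℝ, IsAlgebraic ℚ e₁ ∧ IsAlgebraic ℚ e₂ ∧ e₁ < e₂ ∧ e₁ ^ 3 + A * e₁ + B = 0 ∧
          e₂ ^ 3 + A * e₂ + B = 0 ∧ (∀ x ∈ Set.Ioo e₁ e₂, 0 < x ^ 3 + A * x + B) ∧
          r.domain = {z | z 0 ∈ Set.Ioo e₁ e₂} ∧
          ∃ P₁ P₂ P₃ : Polynomial (algebraicClosure ℚ ℝ), ∀ x ∈ Set.Ioo e₁ e₂,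
            r.integrand (fun _ => x) = Polynomial.aeval x P₁ + Polynomial.aeval x P₂ * Real.sqrt (x ^ 3 + A * x + B) +
              Polynomial.aeval x P₃ / Real.sqrt (x ^ 3 + A * x + B)) ∨
        (∃ e c₀ : ℝ, IsAlgebraic ℚ e ∧ IsAlgebraic ℚ c₀ ∧ e ^ 3 + A * e + B = 0 ∧
          (∀ x : ℝ, e < x → 0 < x ^ 3 + A * x + B) ∧ r.domain = {z | e < z 0} ∧
          ∀ z ∈ r.domain, r.integrand z = c₀ / Real.sqrt ((z 0) ^ 3 + A * (z 0) + B))}) →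
    KZ.eval c = 0 →
    c ∈ AddSubgroup.closure (KZ.domainAddRel ∪ KZ.integrandAddRel ∪ KZ.changeOfVariablesRel ∪
      {g : KZ.FormalRep | ∃ (Δ : Set (Fin 2 → ℝ)) (A B S : (Fin 2 → ℝ) → ℝ) (r₀₁ r₁₂ r₀₂ : KZ.IntegralRep 1),
        Δ = {p | 0 ≤ p 0 ∧ 0 ≤ p 1 ∧ p 0 + p 1 ≤ 1} ∧ IsSemialgebraicFunOn ℚ Δ A ∧ IsSemialgebraicFunOn ℚ Δ B ∧
        ContinuousOn A Δ ∧ ContinuousOn B Δ ∧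
        (∀ p : Fin 2 → ℝ, 0 < p 0 → 0 < p 1 → p 0 + p 1 < 1 →
          HasFDerivAt S (A p • ContinuousLinearMap.proj (R := ℝ) (φ := fun _ : Fin 2 => ℝ) 0 +
            B p • ContinuousLinearMap.proj (R := ℝ) (φ := fun _ : Fin 2 => ℝ) 1) p) ∧
        r₀₁.domain = {z | z 0 ∈ Set.Ioo 0 1} ∧ r₁₂.domain = {z | z 0 ∈ Set.Ioo 0 1} ∧
        r₀₂.domain = {z | z 0 ∈ Set.Ioo 0 1} ∧ (∀ z ∈ r₀₁.domain, r₀₁.integrand z = A ![z 0, 0]) ∧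
        (∀ z ∈ r₁₂.domain, r₁₂.integrand z = B ![1 - z 0, z 0] - A ![1 - z 0, z 0]) ∧
        (∀ z ∈ r₀₂.domain, r₀₂.integrand z = B ![0, z 0]) ∧ g = KZ.of r₀₁ + KZ.of r₁₂ - KZ.of r₀₂}) := by
  intro A B hA hB L hL₂ hL₃ c hc heval
  refine realOnePeriodRelations_ratLoopLayer 1 (fun _ => A) (fun _ => B) (fun _ => hA) (fun _ => hB) (fun _ => L)
    (fun _ => hL₂) (fun _ => hL₃) c (AddSubgroup.closure_mono (Set.image_mono fun r hr => ?_) hc) heval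
  rcases hr with h | h | h | h
  · exact Or.inl h
  · exact Or.inr (Or.inl h)
  · exact Or.inr (Or.inr (Or.inl ⟨0, h⟩))
  · exact Or.inr (Or.inr (Or.inr ⟨0, h⟩))

/-- **THE LOG–LEGENDRE LAYER** — rational representations together with the Legendre forms: for finitely many ALGEBRAIC MODULI
`0 < k_j < 1` (singular moduli included) and lattices `L_j` of the depressed cubics of `legendre_cell`, every `ℤ`-combination
with vanishing value of rational representations (`π`, logarithms of rationals, …), polynomial cells `∫_a^b P` and the Legendre
cells `∫₀¹ P(x²) dx/√((1−x²)(1−k_j²x²))` (`K(k_j)`, `E(k_j)`, …) lies in `M₁`: every Legendre cell is, modulo `M₁`, an oval cell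
of its depressed cubic (`LoopLayer.legendre_cell`: `t = x²`, `u = t − s`), so `realOnePeriodRelations_ratLoopLayer` applies.
[cite: HuberWustholz2022, Thm 13.3 (2), Thm 15.3 (1), Rem. 15.11] [cite: KontsevichZagier2001, §1.1–§1.2] -/
theorem realOnePeriodRelations_ratLegendreLayer : ∀ (n : ℕ) (k : Fin n → ℝ), (∀ j, IsAlgebraic ℚ (k j)) → (∀ j, 0 < k j) →
    (∀ j, k j < 1) → ∀ (L : Fin n → PeriodPair),
    (∀ j, (L j).g₂ = -4 * ((1 / k j ^ 2 - 3 * ((1 + 1 / k j ^ 2) / 3) ^ 2 : ℝ) : ℂ)) →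
    (∀ j, (L j).g₃ = -4 * ((((1 + 1 / k j ^ 2) / 3) / k j ^ 2 - 2 * ((1 + 1 / k j ^ 2) / 3) ^ 3 : ℝ) : ℂ)) →
    ∀ c : KZ.FormalRep, c ∈ AddSubgroup.closure ((fun r : KZ.IntegralRep 1 => KZ.of r) ''
      {r | r.IsRational ∨
        (∃ a b : ℝ, IsAlgebraic ℚ a ∧ IsAlgebraic ℚ b ∧ a < b ∧ r.domain = {z | z 0 ∈ Set.Ioo a b} ∧
            ∃ P : Polynomial (algebraicClosure ℚ ℝ), ∀ x ∈ Set.Ioo a b, r.integrand (fun _ => x) = Polynomial.aeval x P) ∨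
        (∃ j, r.domain = {z | z 0 ∈ Set.Ioo (0 : ℝ) 1} ∧ ∃ P : Polynomial (algebraicClosure ℚ ℝ), ∀ x ∈ Set.Ioo (0 : ℝ) 1,
          r.integrand (fun _ => x) = Polynomial.aeval (x ^ 2) P / Real.sqrt ((1 - x ^ 2) * (1 - k j ^ 2 * x ^ 2)))}) →
    KZ.eval c = 0 →
    c ∈ AddSubgroup.closure (KZ.domainAddRel ∪ KZ.integrandAddRel ∪ KZ.changeOfVariablesRel ∪
      {g : KZ.FormalRep | ∃ (Δ : Set (Fin 2 → ℝ)) (A B S : (Fin 2 → ℝ) → ℝ) (r₀₁ r₁₂ r₀₂ : KZ.IntegralRep 1),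
        Δ = {p | 0 ≤ p 0 ∧ 0 ≤ p 1 ∧ p 0 + p 1 ≤ 1} ∧ IsSemialgebraicFunOn ℚ Δ A ∧ IsSemialgebraicFunOn ℚ Δ B ∧
        ContinuousOn A Δ ∧ ContinuousOn B Δ ∧
        (∀ p : Fin 2 → ℝ, 0 < p 0 → 0 < p 1 → p 0 + p 1 < 1 →
          HasFDerivAt S (A p • ContinuousLinearMap.proj (R := ℝ) (φ := fun _ : Fin 2 => ℝ) 0 +
            B p • ContinuousLinearMap.proj (R := ℝ) (φ := fun _ : Fin 2 => ℝ) 1) p) ∧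
        r₀₁.domain = {z | z 0 ∈ Set.Ioo 0 1} ∧ r₁₂.domain = {z | z 0 ∈ Set.Ioo 0 1} ∧
        r₀₂.domain = {z | z 0 ∈ Set.Ioo 0 1} ∧ (∀ z ∈ r₀₁.domain, r₀₁.integrand z = A ![z 0, 0]) ∧
        (∀ z ∈ r₁₂.domain, r₁₂.integrand z = B ![1 - z 0, z 0] - A ![1 - z 0, z 0]) ∧
        (∀ z ∈ r₀₂.domain, r₀₂.integrand z = B ![0, z 0]) ∧ g = KZ.of r₀₁ + KZ.of r₁₂ - KZ.of r₀₂}) := by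
  intro n k hk hk0 hk1 L hL₂ hL₃ c hc heval
  change c ∈ M₁
  -- the associated Weierstrass data
  set A : Fin n → ℝ := fun j => 1 / k j ^ 2 - 3 * ((1 + 1 / k j ^ 2) / 3) ^ 2 with hA
  set B : Fin n → ℝ := fun j => ((1 + 1 / k j ^ 2) / 3) / k j ^ 2 - 2 * ((1 + 1 / k j ^ 2) / 3) ^ 3 with hB
  have hsalg : ∀ j, IsAlgebraic ℚ ((1 + 1 / k j ^ 2) / 3) := fun j => by
    have h1 : IsAlgebraic ℚ (1 + 1 / k j ^ 2) := isAlgebraic_one.add (by rw [one_div]; exact ((hk j).pow 2).inv)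
    rw [div_eq_mul_inv]; exact h1.mul (isAlgebraic_nat 3).inv
  have hAalg : ∀ j, IsAlgebraic ℚ (A j) := fun j => by
    simp only [hA]
    exact (by rw [one_div]; exact ((hk j).pow 2).inv : IsAlgebraic ℚ (1 / k j ^ 2)).sub
      ((isAlgebraic_nat 3).mul ((hsalg j).pow 2))
  have hBalg : ∀ j, IsAlgebraic ℚ (B j) := fun j => by
    simp only [hB]
    refine IsAlgebraic.sub ?_ ((isAlgebraic_nat 2).mul ((hsalg j).pow 3))
    rw [div_eq_mul_inv]
    exact (hsalg j).mul (by rw [← one_div, one_div]; exact ((hk j).pow 2).inv)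
  -- every `c` in the log–Legendre closure is congruent modulo `M₁` to a `c′` in the log–loop closure
  have key : ∀ c : KZ.FormalRep, c ∈ AddSubgroup.closure ((fun r : KZ.IntegralRep 1 => KZ.of r) ''
      {r | r.IsRational ∨
        (∃ a b : ℝ, IsAlgebraic ℚ a ∧ IsAlgebraic ℚ b ∧ a < b ∧ r.domain = {z | z 0 ∈ Set.Ioo a b} ∧
            ∃ P : Polynomial (algebraicClosure ℚ ℝ), ∀ x ∈ Set.Ioo a b, r.integrand (fun _ => x) = Polynomial.aeval x P) ∨
        (∃ j, r.domain = {z | z 0 ∈ Set.Ioo (0 : ℝ) 1} ∧ ∃ P : Polynomial (algebraicClosure ℚ ℝ), ∀ x ∈ Set.Ioo (0 : ℝ) 1,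
          r.integrand (fun _ => x) = Polynomial.aeval (x ^ 2) P / Real.sqrt ((1 - x ^ 2) * (1 - k j ^ 2 * x ^ 2)))}) →
      ∃ c' : KZ.FormalRep, c' ∈ AddSubgroup.closure ((fun r : KZ.IntegralRep 1 => KZ.of r) ''
      {r | r.IsRational ∨
        (∃ a b : ℝ, IsAlgebraic ℚ a ∧ IsAlgebraic ℚ b ∧ a < b ∧ r.domain = {z | z 0 ∈ Set.Ioo a b} ∧
            ∃ P : Polynomial (algebraicClosure ℚ ℝ), ∀ x ∈ Set.Ioo a b, r.integrand (fun _ => x) = Polynomial.aeval x P) ∨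
        (∃ j, ∃ e₁ e₂ : ℝ, IsAlgebraic ℚ e₁ ∧ IsAlgebraic ℚ e₂ ∧ e₁ < e₂ ∧ e₁ ^ 3 + A j * e₁ + B j = 0 ∧
          e₂ ^ 3 + A j * e₂ + B j = 0 ∧ (∀ x ∈ Set.Ioo e₁ e₂, 0 < x ^ 3 + A j * x + B j) ∧
          r.domain = {z | z 0 ∈ Set.Ioo e₁ e₂} ∧
          ∃ P₁ P₂ P₃ : Polynomial (algebraicClosure ℚ ℝ), ∀ x ∈ Set.Ioo e₁ e₂,
            r.integrand (fun _ => x) = Polynomial.aeval x P₁ + Polynomial.aeval x P₂ * Real.sqrt (x ^ 3 + A j * x + B j) +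
              Polynomial.aeval x P₃ / Real.sqrt (x ^ 3 + A j * x + B j)) ∨
        (∃ j, ∃ e c₀ : ℝ, IsAlgebraic ℚ e ∧ IsAlgebraic ℚ c₀ ∧ e ^ 3 + A j * e + B j = 0 ∧
          (∀ x : ℝ, e < x → 0 < x ^ 3 + A j * x + B j) ∧ r.domain = {z | e < z 0} ∧
          ∀ z ∈ r.domain, r.integrand z = c₀ / Real.sqrt ((z 0) ^ 3 + A j * (z 0) + B j))}) ∧ c - c' ∈ M₁ := by
    intro c hc
    refine AddSubgroup.closure_induction (p := fun c _ => ∃ c' : KZ.FormalRep, c' ∈ _ ∧ c - c' ∈ M₁) ?_ ?_ ?_ ?_ hc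
    · rintro _ ⟨r, hr, rfl⟩
      rcases hr with hrat | hpoly | ⟨j, hdom, P, hint⟩
      · exact ⟨KZ.of r, AddSubgroup.subset_closure ⟨r, Or.inl hrat, rfl⟩, by rw [sub_self]; exact M₁.zero_mem⟩
      · exact ⟨KZ.of r, AddSubgroup.subset_closure ⟨r, Or.inr (Or.inl hpoly), rfl⟩, by rw [sub_self]; exact M₁.zero_mem⟩
      · obtain ⟨ρ, hρ, hrel⟩ := LoopLayer.legendre_cell (k j) (hk j) (hk0 j) (hk1 j) P r hdom hint
        exact ⟨KZ.of ρ, AddSubgroup.subset_closure ⟨ρ, Or.inr (Or.inr (Or.inl ⟨j, hρ⟩)), rfl⟩, hrel⟩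
    · exact ⟨0, AddSubgroup.zero_mem _, by rw [sub_self]; exact M₁.zero_mem⟩
    · rintro c₁ c₂ _ _ ⟨c₁', h₁', h₁⟩ ⟨c₂', h₂', h₂⟩
      refine ⟨c₁' + c₂', AddSubgroup.add_mem _ h₁' h₂', ?_⟩
      have e : c₁ + c₂ - (c₁' + c₂') = (c₁ - c₁') + (c₂ - c₂') := by abel
      rw [e]
      exact M₁.add_mem h₁ h₂
    · rintro c₁ _ ⟨c₁', h₁', h₁⟩
      refine ⟨-c₁', AddSubgroup.neg_mem _ h₁', ?_⟩
      have e : -c₁ - -c₁' = -(c₁ - c₁') := by abel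
      rw [e]
      exact M₁.neg_mem h₁
  obtain ⟨c', hc', hcc'⟩ := key c hc
  have heval' : KZ.eval c' = 0 := by
    have h := Summit.KontsevichZagierPeriods.SymplecticScissors.RealOnePeriodRelationsNegative.eval_eq_zero_of_mem_M₁ hcc'
    rw [map_sub, heval, zero_sub, neg_eq_zero] at h
    exact h
  have hM : c' ∈ M₁ :=
    realOnePeriodRelations_ratLoopLayer n A B hAalg hBalg L (fun j => by rw [hL₂ j]) (fun j => by rw [hL₃ j])
      c' hc' heval'
  have e : c = (c - c') + c' := by abel
  rw [e]
  exact M₁.add_mem hcc' hM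

end LogLoopLayer

end Summit.KontsevichZagierPeriods.SymplecticScissors.RealOnePeriodRelations

end
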